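import Summits.NavierStokesRegularity.NavierStokesRegularity.Theorems.LocalSineTubeDoorGenericDoor
import Summits.NavierStokesRegularity.NavierStokesRegularity.Theorems.ClockStretchingLawClockCeilingZoomScaling
import Summits.NavierStokesRegularity.NavierStokesRegularity.Theorems.PoloidalWindowDoorPoloidalWindowRigidityWindow
import Summits.NavierStokesRegularity.NavierStokesRegularity.Theorems.PoloidalWindowDoorPoloidalWindowRigidityFlat
import Summits.NavierStokesRegularity.NavierStokesRegularity.Theorems.OddMorawetzMorawetzKillsTypeISelfSimilarRigidity
import Literature.Analysis.FluidPDE.SelfSimilar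
import Literature.Analysis.FluidPDE.KatoLocalBoundedPicard
import Literature.Analysis.UnboundedOperators.HeatExtensionUniformTail
import Summits.NavierStokesRegularity.NavierStokesRegularity.Theorems.SqueezeCycleNoApexTypeIProfileTypeIBoundIdle
import Summits.NavierStokesRegularity.NavierStokesRegularity.Theorems.RellichScarApexLocalisationIrrotHalfspaceLiouville
import Literature.Analysis.FluidPDE.TypeIAncientMildDecay
import Literature.Analysis.FluidPDE.TaoEnstrophyLocalisation
import Literature.Analysis.Calculus.DifferenceQuotientHolder
import Literature.Analysis.FluidPDE.BarkerPrange2020VorticityAlignmentTypeIHolds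
import HarnessLib

/-!
# nsreg-p1 ROUND-17 door S18 «LocalConicalFinalStateDoor» (STAGED, HOLD) — THE LINE FOR K2, kernel-resident:
# K2 `ConicalApexRigidity` ⇐ BU `ApexBackwardUniqueness` ⇐ LABU; `Target` ⇐ K1 ∧ K2; rung ⇐ K2 (texts verbatim)

Tree landing of the PROVED compositions of the planner's K2 skeleton (`route-conical/bc/ConicalApexRigidity_birth_v2.lean`
2cd087ed0cde242d, nsreg-p1 g15; the BC5 rung and K1 child 2 are `…LocalConicalFinalStateDoorZeroScarRung` /
`…TopIdentification`).  All statement texts (`Target`, `LocalPointZoomConicalTopSlice`, `ConicalApexRigidity`,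
`ApexBackwardUniqueness`, `LinearisedApexBackwardUniqueness`, `ZeroScarApexRigidity`) are the skeleton's, spelled out verbatim
(the route is not born, so there is no `Theses` file to name them):

* `doorClass_nsRescale` — the door class is invariant under the parabolic rescalings `v ↦ c v(c²·, c·)`;
* `doorClass_selfSimilar_zero` — Tsai on the door class: a door-class profile invariant under ALL parabolic rescalings is `≡ 0`
  (the tree's `…OddMorawetzMorawetzKillsTypeI….stub_selfSimilarRigidity` chain);
* `conicalRigidity_of_bu` — **K2 ⇐ BU**: every rescaling of a profile with conical top slice `w₁` has the SAME top slice, so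
  BU makes the profile self-similar, and Tsai kills it;
* `target_of` — door S18 ⇐ K1 ∧ K2 (zoom, apply K2, contradiction); `zeroScar_of_conical` — the rung is K2 at `w₁ = 0`;
* `bu_of_labu` — **BU ⇐ LABU** (the difference of two door-class flows solves the linearised problem with the class envelope).

Seat nsreg-p6 g10 (THEOREMS-ONLY door sequels, DIRECTOR-NS g8 #32 (2)/#36); credit: statements and proofs nsreg-p1 g15.
WHAT THIS IS NOT: not NS regularity; not K2, BU or LABU (OPEN — LABU/`ExteriorDifferenceBU` is the line's content, see
`…ApexRigidityOfExteriorBU`); no route is opened (S18 staged, HOLD).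
-/

noncomputable section

-- the summit and its single sub-problem share the name (CONVENTIONS §1)
set_option linter.dupNamespace false

namespace Summit.NavierStokesRegularity.NavierStokesRegularity.Theorems.LocalConicalFinalStateDoorApexRigidityOfBU

open MeasureTheory Set Function Filter Topology Metric
open scoped RealInnerProductSpace InnerProductSpace NNReal ENNReal
open Literature.Analysis Literature.Analysis.FluidPDE
open Literature.Analysis.UnboundedOperators (heatExtension)
open Summit.NavierStokesRegularity.NavierStokesRegularity.Theorems
open Summit.NavierStokesRegularity.NavierStokesRegularity.Theorems.PoloidalWindowDoorPoloidalWindowRigidityWindow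
open Summit.NavierStokesRegularity.NavierStokesRegularity.Theorems.PoloidalWindowDoorPoloidalWindowRigidityFlat
  (not_backwardSingular_of_zero)
open Summit.NavierStokesRegularity.NavierStokesRegularity.Theorems.RellichScarApexLocalisationIrrotHalfspaceLiouville
  (not_isBackwardSingularPoint_of_topCurlVanishing_halfspace)
open Summit.NavierStokesRegularity.NavierStokesRegularity.Theorems.NoApexKNSS (exists_pressure_typeIBound_lt_top)
open Literature.Analysis.Calculus (norm_fderiv_fderiv_le_norm_iteratedFDeriv_two)

/-- **The door class is invariant under the parabolic rescalings** `v ↦ c v(c²·, c·)`, `c > 0`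
(tree: `HasTypeITimeDecay.nsRescale`, `HasTypeIDecay.nsRescale`, `zoom_contDiffOn`, `zoom_mild`,
`zoom_isDivFree`, with the joint smoothness of the class `isTypeIAncientMild_of_class`). -/
theorem doorClass_nsRescale {C D : ℝ} {v : ℝ → (EuclideanSpace ℝ (Fin 3)) → (EuclideanSpace ℝ (Fin 3))}
    (hrate : HasTypeITimeDecay C v) (hdecay : HasTypeIDecay D v)
    (hcont : ContinuousOn (Function.uncurry v) (Set.Iio (0 : ℝ) ×ˢ Set.univ))
    (hmild : ∀ s t : ℝ, s < t → t < 0 → ∀ x, v t x =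
      UnboundedOperators.heatExtension (v s) (t - s) x - oseenDuhamel 1 s v v t x)
    (hdiv : ∀ t < 0, VectorCalculus.IsDivFree (v t)) {c : ℝ} (hc : 0 < c) :
    HasTypeITimeDecay C (nsRescale c v) ∧ HasTypeIDecay D (nsRescale c v) ∧
    ContinuousOn (Function.uncurry (nsRescale c v)) (Set.Iio (0 : ℝ) ×ˢ Set.univ) ∧
    (∀ s t : ℝ, s < t → t < 0 → ∀ x, nsRescale c v t x =
      UnboundedOperators.heatExtension (nsRescale c v s) (t - s) x -
        oseenDuhamel 1 s (nsRescale c v) (nsRescale c v) t x) ∧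
    (∀ t < 0, VectorCalculus.IsDivFree (nsRescale c v t)) := by
  have hT : IsTypeIAncientMild C v := isTypeIAncientMild_of_class hrate hcont hmild hdiv
  exact ⟨hrate.nsRescale hc, hdecay.nsRescale hc, (zoom_contDiffOn hT.contDiffOn hc).continuousOn,
    zoom_mild hmild hc,
    zoom_isDivFree hdiv (fun t ht => (hT.contDiff_slice ht).differentiable (by simp)) hc⟩

/-- **Tsai's theorem on the door class, per-slice form**: a door-class profile which is self-similar
on the open backward slab (`c v(c²t, c·) = v(t, ·)` for every `c > 0` and every `t < 0`) vanishes
there.  (Extend `v` by `0` to `t ≥ 0`; the extension is `IsSelfSimilar` and `IsTypeIAncientMild`, and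
the tree's `stub_selfSimilarRigidity` — Tsai 1998 Thm 1 in the Oseen gauge — applies.) -/
theorem doorClass_selfSimilar_zero {C : ℝ} {v : ℝ → (EuclideanSpace ℝ (Fin 3)) → (EuclideanSpace ℝ (Fin 3))}
    (hrate : HasTypeITimeDecay C v)
    (hcont : ContinuousOn (Function.uncurry v) (Set.Iio (0 : ℝ) ×ˢ Set.univ))
    (hmild : ∀ s t : ℝ, s < t → t < 0 → ∀ x, v t x =
      UnboundedOperators.heatExtension (v s) (t - s) x - oseenDuhamel 1 s v v t x)
    (hdiv : ∀ t < 0, VectorCalculus.IsDivFree (v t))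
    (hss : ∀ c : ℝ, 0 < c → ∀ t < 0, nsRescale c v t = v t) :
    ∀ t < 0, ∀ x, v t x = 0 := by
  -- the extension by zero to nonnegative times
  set w : ℝ → (EuclideanSpace ℝ (Fin 3)) → (EuclideanSpace ℝ (Fin 3)) := fun t x => if t < 0 then v t x else 0 with hw
  have hEq : ∀ t < 0, w t = v t := fun t ht => funext fun x => by simp [hw, ht]
  have hEq0 : ∀ t, ¬ t < 0 → w t = 0 := fun t ht => funext fun x => by simp [hw, ht]
  -- `w` is in the class
  have hwrate : HasTypeITimeDecay C w := fun t ht x => by rw [hEq t ht]; exact hrate t ht x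
  have hwcont : ContinuousOn (Function.uncurry w) (Set.Iio (0 : ℝ) ×ˢ Set.univ) := by
    refine hcont.congr fun q hq => ?_
    obtain ⟨hq1, -⟩ := Set.mem_prod.1 hq
    show w q.1 q.2 = v q.1 q.2
    rw [hEq q.1 (Set.mem_Iio.1 hq1)]
  have hwmild : ∀ s t : ℝ, s < t → t < 0 → ∀ x, w t x =
      UnboundedOperators.heatExtension (w s) (t - s) x - oseenDuhamel 1 s w w t x := by
    intro s t hst ht x
    have hs : s < 0 := hst.trans ht
    have hO : oseenDuhamel 1 s w w t x = oseenDuhamel 1 s v v t x := by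
      rw [oseenDuhamel_apply, oseenDuhamel_apply]
      refine setIntegral_congr_fun measurableSet_Ioo fun τ hτ => ?_
      simp only [hEq τ (hτ.2.trans ht)]
    rw [hEq t ht, hEq s hs, hO]
    exact hmild s t hst ht x
  have hwdiv : ∀ t < 0, VectorCalculus.IsDivFree (w t) := fun t ht => by
    rw [hEq t ht]; exact hdiv t ht
  have hwT : IsTypeIAncientMild C w := isTypeIAncientMild_of_class hwrate hwcont hwmild hwdiv
  -- `w` is self-similar at all times
  have hwss : IsSelfSimilar w := by
    intro c hc
    funext t x
    rw [nsRescale_apply]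
    by_cases ht : t < 0
    · have hct : c ^ 2 * t < 0 := mul_neg_of_pos_of_neg (by positivity) ht
      rw [hEq t ht, hEq _ hct, ← nsRescale_apply c v t x, hss c hc t ht]
    · have hct : ¬ c ^ 2 * t < 0 := by
        intro h'
        exact ht (by nlinarith [sq_nonneg c, pow_pos hc 2])
      rw [hEq0 t ht, hEq0 _ hct]
      simp
  -- Tsai
  intro t ht x
  have := stub_selfSimilarRigidity C w hwT hwss t ht x
  rwa [hEq t ht] at this

/-- **K2 ⇐ BU**, kernel-checked.  Every rescaling `v_c` of a door-class profile with conical top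
slice `w₁` is a door-class profile with the SAME top slice, so `v_c − v` vanishes at the top at the
cubic rate (constant `2K`); BU gives `v_c = v` on `t < 0`; Tsai gives `v = 0` there. -/
theorem conicalRigidity_of_bu (hBU : (∀ (C D K : ℝ) (v₁ v₂ : ℝ → (EuclideanSpace ℝ (Fin 3)) → (EuclideanSpace ℝ (Fin 3))),
  HasTypeITimeDecay C v₁ →
  HasTypeIDecay D v₁ →
  ContinuousOn (Function.uncurry v₁) (Set.Iio (0 : ℝ) ×ˢ Set.univ) →
  (∀ s t : ℝ, s < t → t < 0 → ∀ x, v₁ t x =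
    UnboundedOperators.heatExtension (v₁ s) (t - s) x - oseenDuhamel 1 s v₁ v₁ t x) →
  (∀ t < 0, VectorCalculus.IsDivFree (v₁ t)) →
  HasTypeITimeDecay C v₂ →
  HasTypeIDecay D v₂ →
  ContinuousOn (Function.uncurry v₂) (Set.Iio (0 : ℝ) ×ˢ Set.univ) →
  (∀ s t : ℝ, s < t → t < 0 → ∀ x, v₂ t x =
    UnboundedOperators.heatExtension (v₂ s) (t - s) x - oseenDuhamel 1 s v₂ v₂ t x) →
  (∀ t < 0, VectorCalculus.IsDivFree (v₂ t)) →
  (∀ t < 0, ∀ y : (EuclideanSpace ℝ (Fin 3)), y ≠ 0 → ‖v₁ t y - v₂ t y‖ ≤ K * (-t) / ‖y‖ ^ 3) →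
  ∀ t < 0, v₁ t = v₂ t)) : (∀ (C D K : ℝ) (v : ℝ → (EuclideanSpace ℝ (Fin 3)) → (EuclideanSpace ℝ (Fin 3))) (w₁ : (EuclideanSpace ℝ (Fin 3)) → (EuclideanSpace ℝ (Fin 3))),
  HasTypeITimeDecay C v →
  HasTypeIDecay D v →
  ContinuousOn (Function.uncurry v) (Set.Iio (0 : ℝ) ×ˢ Set.univ) →
  (∀ s t : ℝ, s < t → t < 0 → ∀ x, v t x =
    UnboundedOperators.heatExtension (v s) (t - s) x - oseenDuhamel 1 s v v t x) →
  (∀ t < 0, VectorCalculus.IsDivFree (v t)) →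
  (∀ c : ℝ, 0 < c → ∀ z, w₁ (c • z) = c⁻¹ • w₁ z) →
  (∀ t < 0, ∀ y : (EuclideanSpace ℝ (Fin 3)), y ≠ 0 → ‖v t y - w₁ y‖ ≤ K * (-t) / ‖y‖ ^ 3) →
  ¬ IsBackwardSingularPoint v 0) := by
  intro C D K v w₁ hrate hdecay hcont hmild hdiv hhom hcone
  refine not_backwardSingular_of_zero (doorClass_selfSimilar_zero hrate hcont hmild hdiv fun c hc => ?_)
  obtain ⟨hrate', hdecay', hcont', hmild', hdiv'⟩ := doorClass_nsRescale hrate hdecay hcont hmild hdiv hc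
  -- the rescaled profile has the same top cone, with the same contact constant
  have hcone' : ∀ t < 0, ∀ y : (EuclideanSpace ℝ (Fin 3)), y ≠ 0 → ‖nsRescale c v t y - w₁ y‖ ≤ K * (-t) / ‖y‖ ^ 3 := by
    intro t ht y hy
    have hct : c ^ 2 * t < 0 := mul_neg_of_pos_of_neg (by positivity) ht
    have hcy : c • y ≠ 0 := smul_ne_zero hc.ne' hy
    have h1 := hcone (c ^ 2 * t) hct (c • y) hcy
    have e : nsRescale c v t y - w₁ y = c • (v (c ^ 2 * t) (c • y) - w₁ (c • y)) := by
      rw [nsRescale_apply, hhom c hc y, smul_sub, smul_smul, mul_inv_cancel₀ hc.ne', one_smul]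
    rw [e, norm_smul, Real.norm_of_nonneg hc.le]
    have hny : 0 < ‖y‖ := norm_pos_iff.2 hy
    have e2 : K * (-(c ^ 2 * t)) / ‖c • y‖ ^ 3 = c⁻¹ * (K * (-t) / ‖y‖ ^ 3) := by
      rw [norm_smul, Real.norm_of_nonneg hc.le]
      field_simp
    rw [e2] at h1
    calc c * ‖v (c ^ 2 * t) (c • y) - w₁ (c • y)‖ ≤ c * (c⁻¹ * (K * (-t) / ‖y‖ ^ 3)) := by gcongr
      _ = K * (-t) / ‖y‖ ^ 3 := by field_simp
  have hdiff : ∀ t < 0, ∀ y : (EuclideanSpace ℝ (Fin 3)), y ≠ 0 →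
      ‖nsRescale c v t y - v t y‖ ≤ (K + K) * (-t) / ‖y‖ ^ 3 := by
    intro t ht y hy
    calc ‖nsRescale c v t y - v t y‖
        ≤ ‖nsRescale c v t y - w₁ y‖ + ‖w₁ y - v t y‖ := norm_sub_le_norm_sub_add_norm_sub _ _ _
      _ ≤ K * (-t) / ‖y‖ ^ 3 + K * (-t) / ‖y‖ ^ 3 := by
          gcongr
          · exact hcone' t ht y hy
          · rw [norm_sub_rev]; exact hcone t ht y hy
      _ = (K + K) * (-t) / ‖y‖ ^ 3 := by ring
  exact hBU C D (K + K) (nsRescale c v) v hrate' hdecay' hcont' hmild' hdiv'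
    hrate hdecay hcont hmild hdiv hdiff

/-- assembly (rank 1), kernel-checked: door S18 ⇐ K1 ∧ K2. -/
theorem target_of (hK1 : (∀ (ν T : ℝ), 0 < ν → 0 < T → ∀ (u : ℝ → (EuclideanSpace ℝ (Fin 3)) → (EuclideanSpace ℝ (Fin 3))) (p : ℝ → (EuclideanSpace ℝ (Fin 3)) → ℝ),
  IsClassicalNSSolutionOn (Set.Ico 0 T) ν 0 u p →
  IsLerayHopfOn T ν 0 (u 0) u →
  HasRapidSpatialDecay (u 0) →
  ∀ (x₀ : (EuclideanSpace ℝ (Fin 3))) (ρ M : ℝ), 0 < ρ →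
  (∀ t ∈ Set.Ico 0 T, T - ρ ^ 2 < t → ∀ x ∈ Metric.ball x₀ ρ,
      ‖u t x‖ * (‖x - x₀‖ + Real.sqrt (ν * (T - t))) ≤ M) →
  (∀ x ∈ Metric.ball x₀ ρ, x ≠ x₀ → Tendsto (fun t => u t x) (𝓝[<] T) (𝓝 (u T x))) →
  (∃ w₀ : (EuclideanSpace ℝ (Fin 3)) → (EuclideanSpace ℝ (Fin 3)), (∀ c : ℝ, 0 < c → ∀ z, w₀ (c • z) = c⁻¹ • w₀ z) ∧
    Tendsto (fun x => ‖x - x₀‖ * ‖u T x - w₀ (x - x₀)‖) (𝓝[≠] x₀) (𝓝 0)) →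
  ¬ IsBackwardBoundedAt u T x₀ →
  ∃ (C D K : ℝ) (v : ℝ → (EuclideanSpace ℝ (Fin 3)) → (EuclideanSpace ℝ (Fin 3))) (w₁ : (EuclideanSpace ℝ (Fin 3)) → (EuclideanSpace ℝ (Fin 3))),
    HasTypeITimeDecay C v ∧ HasTypeIDecay D v ∧
    ContinuousOn (Function.uncurry v) (Set.Iio (0 : ℝ) ×ˢ Set.univ) ∧
    (∀ s t : ℝ, s < t → t < 0 → ∀ x, v t x =
      UnboundedOperators.heatExtension (v s) (t - s) x - oseenDuhamel 1 s v v t x) ∧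
    (∀ t < 0, VectorCalculus.IsDivFree (v t)) ∧
    IsBackwardSingularPoint v 0 ∧
    (∀ c : ℝ, 0 < c → ∀ z, w₁ (c • z) = c⁻¹ • w₁ z) ∧
    (∀ t < 0, ∀ y : (EuclideanSpace ℝ (Fin 3)), y ≠ 0 → ‖v t y - w₁ y‖ ≤ K * (-t) / ‖y‖ ^ 3))) (hK2 : (∀ (C D K : ℝ) (v : ℝ → (EuclideanSpace ℝ (Fin 3)) → (EuclideanSpace ℝ (Fin 3))) (w₁ : (EuclideanSpace ℝ (Fin 3)) → (EuclideanSpace ℝ (Fin 3))),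
  HasTypeITimeDecay C v →
  HasTypeIDecay D v →
  ContinuousOn (Function.uncurry v) (Set.Iio (0 : ℝ) ×ˢ Set.univ) →
  (∀ s t : ℝ, s < t → t < 0 → ∀ x, v t x =
    UnboundedOperators.heatExtension (v s) (t - s) x - oseenDuhamel 1 s v v t x) →
  (∀ t < 0, VectorCalculus.IsDivFree (v t)) →
  (∀ c : ℝ, 0 < c → ∀ z, w₁ (c • z) = c⁻¹ • w₁ z) →
  (∀ t < 0, ∀ y : (EuclideanSpace ℝ (Fin 3)), y ≠ 0 → ‖v t y - w₁ y‖ ≤ K * (-t) / ‖y‖ ^ 3) →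
  ¬ IsBackwardSingularPoint v 0)) : (∀ (ν T : ℝ), 0 < ν → 0 < T → ∀ (u : ℝ → (EuclideanSpace ℝ (Fin 3)) → (EuclideanSpace ℝ (Fin 3))) (p : ℝ → (EuclideanSpace ℝ (Fin 3)) → ℝ),
  IsClassicalNSSolutionOn (Set.Ico 0 T) ν 0 u p →
  IsLerayHopfOn T ν 0 (u 0) u →
  HasRapidSpatialDecay (u 0) →
  ∀ (x₀ : (EuclideanSpace ℝ (Fin 3))) (ρ M : ℝ), 0 < ρ →
  (∀ t ∈ Set.Ico 0 T, T - ρ ^ 2 < t → ∀ x ∈ Metric.ball x₀ ρ,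
      ‖u t x‖ * (‖x - x₀‖ + Real.sqrt (ν * (T - t))) ≤ M) →
  (∀ x ∈ Metric.ball x₀ ρ, x ≠ x₀ → Tendsto (fun t => u t x) (𝓝[<] T) (𝓝 (u T x))) →
  (∃ w₀ : (EuclideanSpace ℝ (Fin 3)) → (EuclideanSpace ℝ (Fin 3)), (∀ c : ℝ, 0 < c → ∀ z, w₀ (c • z) = c⁻¹ • w₀ z) ∧
    Tendsto (fun x => ‖x - x₀‖ * ‖u T x - w₀ (x - x₀)‖) (𝓝[≠] x₀) (𝓝 0)) →
  IsBackwardBoundedAt u T x₀) := by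
  intro ν T hν hT u p hcl hLH hdec x₀ ρ M hρ hM htrace hcone
  by_contra hnot
  obtain ⟨C, D, K, v, w₁, hrate, hdecay, hcont, hmild, hdiv, hsing, hhom, hvc⟩ :=
    hK1 ν T hν hT u p hcl hLH hdec x₀ ρ M hρ hM htrace hcone hnot
  exact hK2 C D K v w₁ hrate hdecay hcont hmild hdiv hhom hvc hsing

/-- The zero-cone rung is the `w₁ = 0` instance of K2. -/
theorem zeroScar_of_conical (hK2 : (∀ (C D K : ℝ) (v : ℝ → (EuclideanSpace ℝ (Fin 3)) → (EuclideanSpace ℝ (Fin 3))) (w₁ : (EuclideanSpace ℝ (Fin 3)) → (EuclideanSpace ℝ (Fin 3))),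
  HasTypeITimeDecay C v →
  HasTypeIDecay D v →
  ContinuousOn (Function.uncurry v) (Set.Iio (0 : ℝ) ×ˢ Set.univ) →
  (∀ s t : ℝ, s < t → t < 0 → ∀ x, v t x =
    UnboundedOperators.heatExtension (v s) (t - s) x - oseenDuhamel 1 s v v t x) →
  (∀ t < 0, VectorCalculus.IsDivFree (v t)) →
  (∀ c : ℝ, 0 < c → ∀ z, w₁ (c • z) = c⁻¹ • w₁ z) →
  (∀ t < 0, ∀ y : (EuclideanSpace ℝ (Fin 3)), y ≠ 0 → ‖v t y - w₁ y‖ ≤ K * (-t) / ‖y‖ ^ 3) →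
  ¬ IsBackwardSingularPoint v 0)) : (∀ (C D K : ℝ) (v : ℝ → (EuclideanSpace ℝ (Fin 3)) → (EuclideanSpace ℝ (Fin 3))),
  HasTypeITimeDecay C v →
  HasTypeIDecay D v →
  ContinuousOn (Function.uncurry v) (Set.Iio (0 : ℝ) ×ˢ Set.univ) →
  (∀ s t : ℝ, s < t → t < 0 → ∀ x, v t x =
    UnboundedOperators.heatExtension (v s) (t - s) x - oseenDuhamel 1 s v v t x) →
  (∀ t < 0, VectorCalculus.IsDivFree (v t)) →
  (∀ t < 0, ∀ y : (EuclideanSpace ℝ (Fin 3)), y ≠ 0 → ‖v t y‖ ≤ K * (-t) / ‖y‖ ^ 3) →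
  ¬ IsBackwardSingularPoint v 0) := by
  intro C D K v hrate hdecay hcont hmild hdiv hscar
  refine hK2 C D K v 0 hrate hdecay hcont hmild hdiv (fun c _ z => by simp) fun t ht y hy => ?_
  simpa using hscar t ht y hy

/-- **BU ⇐ LABU**, kernel-checked: the difference of two door-class flows solves the linearised
Oseen-mild equation around the pair (Lemarié-Rieusset 2016, proof of Thm 5.1; tree
`oseenDuhamel_self_sub_self`, with the boundedness `‖vᵢ(τ,·)‖ ≤ C/√(−t)` on `(s,t)` and the
measurability of the continuous class), has the envelope `2D/(‖y‖+√(−t))`, and the cubic rate is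
the hypothesis of BU. -/
theorem bu_of_labu (h : (∀ (C D E K : ℝ) (a b Z : ℝ → (EuclideanSpace ℝ (Fin 3)) → (EuclideanSpace ℝ (Fin 3))),
  HasTypeITimeDecay C a →
  HasTypeIDecay D a →
  ContinuousOn (Function.uncurry a) (Set.Iio (0 : ℝ) ×ˢ Set.univ) →
  (∀ s t : ℝ, s < t → t < 0 → ∀ x, a t x =
    UnboundedOperators.heatExtension (a s) (t - s) x - oseenDuhamel 1 s a a t x) →
  (∀ t < 0, VectorCalculus.IsDivFree (a t)) →
  HasTypeITimeDecay C b →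
  HasTypeIDecay D b →
  ContinuousOn (Function.uncurry b) (Set.Iio (0 : ℝ) ×ˢ Set.univ) →
  (∀ s t : ℝ, s < t → t < 0 → ∀ x, b t x =
    UnboundedOperators.heatExtension (b s) (t - s) x - oseenDuhamel 1 s b b t x) →
  (∀ t < 0, VectorCalculus.IsDivFree (b t)) →
  ContinuousOn (Function.uncurry Z) (Set.Iio (0 : ℝ) ×ˢ Set.univ) →
  (∀ s t : ℝ, s < t → t < 0 → ∀ x, Z t x =
    UnboundedOperators.heatExtension (Z s) (t - s) x -
      (oseenDuhamel 1 s Z a t x + oseenDuhamel 1 s b Z t x)) →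
  (∀ t < 0, ∀ y : (EuclideanSpace ℝ (Fin 3)), ‖Z t y‖ ≤ E / (‖y‖ + Real.sqrt (-t))) →
  (∀ t < 0, ∀ y : (EuclideanSpace ℝ (Fin 3)), y ≠ 0 → ‖Z t y‖ ≤ K * (-t) / ‖y‖ ^ 3) →
  ∀ t < 0, ∀ x, Z t x = 0)) : (∀ (C D K : ℝ) (v₁ v₂ : ℝ → (EuclideanSpace ℝ (Fin 3)) → (EuclideanSpace ℝ (Fin 3))),
  HasTypeITimeDecay C v₁ →
  HasTypeIDecay D v₁ →
  ContinuousOn (Function.uncurry v₁) (Set.Iio (0 : ℝ) ×ˢ Set.univ) →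
  (∀ s t : ℝ, s < t → t < 0 → ∀ x, v₁ t x =
    UnboundedOperators.heatExtension (v₁ s) (t - s) x - oseenDuhamel 1 s v₁ v₁ t x) →
  (∀ t < 0, VectorCalculus.IsDivFree (v₁ t)) →
  HasTypeITimeDecay C v₂ →
  HasTypeIDecay D v₂ →
  ContinuousOn (Function.uncurry v₂) (Set.Iio (0 : ℝ) ×ˢ Set.univ) →
  (∀ s t : ℝ, s < t → t < 0 → ∀ x, v₂ t x =
    UnboundedOperators.heatExtension (v₂ s) (t - s) x - oseenDuhamel 1 s v₂ v₂ t x) →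
  (∀ t < 0, VectorCalculus.IsDivFree (v₂ t)) →
  (∀ t < 0, ∀ y : (EuclideanSpace ℝ (Fin 3)), y ≠ 0 → ‖v₁ t y - v₂ t y‖ ≤ K * (-t) / ‖y‖ ^ 3) →
  ∀ t < 0, v₁ t = v₂ t) := by
  intro C D K v₁ v₂ hr1 hd1 hc1 hm1 hdiv1 hr2 hd2 hc2 hm2 hdiv2 hdiff t ht
  have hT1 : IsTypeIAncientMild C v₁ := isTypeIAncientMild_of_class hr1 hc1 hm1 hdiv1
  have hT2 : IsTypeIAncientMild C v₂ := isTypeIAncientMild_of_class hr2 hc2 hm2 hdiv2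
  -- the constant `C` is nonnegative (the class is nonempty at `t`)
  have hC : 0 ≤ C := by
    have h0 := (norm_nonneg _).trans (hr1 t ht 0)
    have := (le_div_iff₀ (Real.sqrt_pos.2 (neg_pos.2 ht))).1 h0
    simpa using this
  have hZ := h C D (D + D) K v₁ v₂ (fun τ y => v₁ τ y - v₂ τ y) hr1 hd1 hc1 hm1 hdiv1
    hr2 hd2 hc2 hm2 hdiv2 ?_ ?_ ?_ ?_
  · funext x
    have := hZ t ht x
    simpa [sub_eq_zero] using this
  · -- continuity of the difference on the open slab
    exact (hc1.sub hc2).congr fun q _ => rfl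
  · -- the linearised mild equation
    intro s t' hst ht' x
    have hs : s < 0 := hst.trans ht'
    have hts : 0 < t' - s := by linarith
    -- boundedness of the two flows on `(s, t')`
    have hsq : ∀ τ ∈ Set.Ioo s t', Real.sqrt (-t') ≤ Real.sqrt (-τ) := fun τ hτ =>
      Real.sqrt_le_sqrt (by linarith [hτ.2])
    have hB1 : ∀ τ ∈ Set.Ioo s t', ∀ y, ‖v₁ τ y‖ ≤ C / Real.sqrt (-t') := fun τ hτ y =>
      (hr1 τ (hτ.2.trans ht') y).trans
        (div_le_div_of_nonneg_left hC (Real.sqrt_pos.2 (neg_pos.2 ht')) (hsq τ hτ))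
    have hB2 : ∀ τ ∈ Set.Ioo s t', ∀ y, ‖v₂ τ y‖ ≤ C / Real.sqrt (-t') := fun τ hτ y =>
      (hr2 τ (hτ.2.trans ht') y).trans
        (div_le_div_of_nonneg_left hC (Real.sqrt_pos.2 (neg_pos.2 ht')) (hsq τ hτ))
    have hsplit := oseenDuhamel_self_sub_self (ν := (1 : ℝ)) (s := s) (T := t') one_pos
      (hT1.aestronglyMeasurable_uncurry ht'.le) (hT2.aestronglyMeasurable_uncurry ht'.le)
      hB1 hB2 hst le_rfl x
    -- additivity of the caloric extension on bounded continuous slices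
    have hM1 : MemLp (v₁ s) ∞ (volume : Measure (EuclideanSpace ℝ (Fin 3))) :=
      memLp_top_of_bound (hT1.continuous_slice hs).aestronglyMeasurable (C / Real.sqrt (-s))
        (Eventually.of_forall (hr1 s hs))
    have hM2 : MemLp (fun y => -v₂ s y) ∞ (volume : Measure (EuclideanSpace ℝ (Fin 3))) := by
      have h2 : MemLp (v₂ s) ∞ (volume : Measure (EuclideanSpace ℝ (Fin 3))) :=
        memLp_top_of_bound (hT2.continuous_slice hs).aestronglyMeasurable (C / Real.sqrt (-s))
          (Eventually.of_forall (hr2 s hs))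
      exact h2.neg
    have e1 : (fun y => v₁ s y - v₂ s y) = (v₁ s) + (fun y => -v₂ s y) := by
      funext y; simp [sub_eq_add_neg]
    have e2 : UnboundedOperators.heatExtension (fun y => -v₂ s y) (t' - s) x =
        -UnboundedOperators.heatExtension (v₂ s) (t' - s) x := by
      simp only [UnboundedOperators.heatExtension_apply, smul_neg, integral_neg]
    have hheat : UnboundedOperators.heatExtension (fun y => v₁ s y - v₂ s y) (t' - s) x =
        UnboundedOperators.heatExtension (v₁ s) (t' - s) x -
          UnboundedOperators.heatExtension (v₂ s) (t' - s) x := by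
      rw [e1, UnboundedOperators.heatExtension_add_apply_of_memLp' hM1 hM2 le_top hts x, e2,
        ← sub_eq_add_neg]
    show v₁ t' x - v₂ t' x = _
    rw [hheat, ← hsplit, hm1 s t' hst ht' x, hm2 s t' hst ht' x]
    abel
  · -- the Type-I envelope of the difference
    intro t' ht' y
    calc ‖v₁ t' y - v₂ t' y‖ ≤ ‖v₁ t' y‖ + ‖v₂ t' y‖ := norm_sub_le _ _
      _ ≤ D / (‖y‖ + Real.sqrt (-t')) + D / (‖y‖ + Real.sqrt (-t')) :=
          add_le_add (hd1 t' ht' y) (hd2 t' ht' y)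
      _ = (D + D) / (‖y‖ + Real.sqrt (-t')) := by rw [add_div]
  · exact hdiff

end Summit.NavierStokesRegularity.NavierStokesRegularity.Theorems.LocalConicalFinalStateDoorApexRigidityOfBU

end
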